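import Mathlib
import Literature.Computability.Complexity.Rossman2008CliqueProofs
import Summits.PneNP.PneNP.Theorems.ConvexRankGatesConvexGateBlindSoftWindow

/-!
# PneNP / ConvexRankGates — `ConvexGateBlind`: the Johnson-scheme kernel of the pair-inclusion map

Helpers (`--supports stmt-PneNP-10680`), first file of the COLUMN-SPACE line (prover seat 2, session 13).
An edge weighting `w` of `K_m` is *`k`-clique-non-negative* (valid) if `w(E(Q)) = ∑_{e ⊆ Q} w(e) ≥ 0` for every
`k`-set `Q` (`softWindow w Q` in the vocabulary of `…SoftWindow.lean`). These are exactly the `Q`-side generators of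
the negative covers of `…NegCover.lean`, i.e. of the factorisations of `D − εJ` whose row objects lie in the column
space `span{[e ⊆ Q]}` (restricted non-negative rank in the sense of Gillis–Glineur). The linear inequalities on valid
weightings that drive the catch-probability bound of the line (`…CliqueNonnegL1.lean`) all come from ONE identity:

* `johnson_kernel` — with `c₁ = (k-2)/(m-k)`, `c₂ = (k-1)(k-2)/((m-k)(m-k-1))` and
  `g(e,Q) = 𝟙[e ⊆ Q] − c₁·𝟙[#(e ∩ Q) = 1] + c₂·𝟙[e ∩ Q = ∅]` (written linearly as `A·𝟙[e ⊆ Q] − B·#(e ∩ Q) + c₂`,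
  `A = 1 + 2c₁ + c₂`, `B = c₁ + c₂`):  `∑_{#Q = k, Q ⊇ f} g(e,Q) = C(m-2,k-2)·[e = f]`  — i.e. `Q ↦ λ_Q(ω) = ∑_e ω(e) g(e,Q)`
  is the least-squares (Bose–Mesner) preimage of `ω` under `Xᵀ : λ ↦ (e ↦ ∑_{Q ⊇ e} λ_Q)`;
* `sum_sum_mul_softWindow_of_kernel` — transfer: `∑_Q λ_Q(ω)·w(E(Q)) = C(m-2,k-2)·∑_e ω(e) w(e)`, hence
  (`inner_nonneg_of_kernel`) `⟨ω, w⟩ ≥ 0` for every valid `w` as soon as all `λ_Q(ω) ≥ 0`: every such `ω` is a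
  non-negative combination of `k`-clique indicators.
[new; elementary linear algebra of the Johnson scheme `J(m,2)`]
-/

set_option linter.dupNamespace false

namespace Summit.PneNP.PneNP.Theorems

open Finset
open Summit.PneNP.PneNP.Cruxes.ConvexGateBlind.StrictRankConicCover (Edge)

noncomputable section

variable {m : ℕ}

/-! ## Counting `k`-sets over an edge -/

/-- The number of `k`-sets containing a vertex set `A`, as a real sum of indicators (`card_filter_powersetCard_superset`).
[folklore] -/
theorem sum_powersetCard_ite_superset (A : Finset (Fin m)) {k : ℕ} (hA : A.card ≤ k) :
    ∑ Q ∈ (Finset.univ : Finset (Fin m)).powersetCard k, (if A ⊆ Q then (1 : ℝ) else 0) =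
      (Nat.choose (m - A.card) (k - A.card) : ℝ) := by
  rw [Finset.sum_boole, card_filter_powersetCard_superset A hA]

/-- Two edges span `4` vertices counted with multiplicity: `#(e ∪ f) + #(e ∩ f) = 4`. [folklore] -/
theorem card_edgeVerts_union_add_inter (e f : Edge m) :
    (edgeVerts e ∪ edgeVerts f).card + (edgeVerts e ∩ edgeVerts f).card = 4 := by
  rw [card_union_add_card_inter, card_edgeVerts, card_edgeVerts]

/-- The number of endpoints of `e` outside `f` is `#(e ∪ f) − 2`. [folklore] -/
theorem card_edgeVerts_sdiff (e f : Edge m) :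
    (edgeVerts e \ edgeVerts f).card = (edgeVerts e ∪ edgeVerts f).card - 2 := by
  have h1 := card_sdiff_add_card_inter (edgeVerts e) (edgeVerts f)
  have h2 := card_edgeVerts_union_add_inter e f
  rw [card_edgeVerts] at h1
  omega

/-- `∑_{#Q = k, f ⊆ Q} #(e ∩ Q) = #(e ∩ f)·C(m-2,k-2) + #(e ∖ f)·C(m-3,k-3)` (`3 ≤ k`): an endpoint of `e` that is an
endpoint of `f` lies in every such `Q`, any other endpoint lies in `C(m-3,k-3)` of them. [folklore] -/
theorem sum_superset_card_inter (e f : Edge m) {k : ℕ} (hk : 3 ≤ k) :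
    ∑ Q ∈ ((Finset.univ : Finset (Fin m)).powersetCard k).filter (fun Q => edgeVerts f ⊆ Q),
        ((edgeVerts e ∩ Q).card : ℝ) =
      (edgeVerts e ∩ edgeVerts f).card * (Nat.choose (m - 2) (k - 2) : ℝ) +
        (edgeVerts e \ edgeVerts f).card * (Nat.choose (m - 3) (k - 3) : ℝ) := by
  classical
  -- `#(edgeVerts e ∩ Q) = ∑_{v ∈ edgeVerts e} 𝟙[v ∈ Q]`, then swap and count supersets of `insert v (edgeVerts f)`
  have hcard : ∀ Q : Finset (Fin m), ((edgeVerts e ∩ Q).card : ℝ) =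
      ∑ v ∈ edgeVerts e, if v ∈ Q then (1 : ℝ) else 0 := by
    intro Q
    rw [Finset.sum_boole, Finset.filter_mem_eq_inter]
  rw [Finset.sum_congr rfl (fun Q _ => hcard Q), Finset.sum_comm]
  have hv : ∀ v ∈ edgeVerts e,
      ∑ Q ∈ ((Finset.univ : Finset (Fin m)).powersetCard k).filter (fun Q => edgeVerts f ⊆ Q),
          (if v ∈ Q then (1 : ℝ) else 0) =
        (Nat.choose (m - (insert v (edgeVerts f)).card) (k - (insert v (edgeVerts f)).card) : ℝ) := by
    intro v _
    have hcard3 : (insert v (edgeVerts f)).card ≤ 3 := by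
      calc (insert v (edgeVerts f)).card ≤ (edgeVerts f).card + 1 := Finset.card_insert_le _ _
        _ = 3 := by rw [card_edgeVerts]
    rw [Finset.sum_filter, ← sum_powersetCard_ite_superset (insert v (edgeVerts f)) (by omega)]
    refine Finset.sum_congr rfl fun Q _ => ?_
    by_cases h1 : edgeVerts f ⊆ Q <;> by_cases h2 : v ∈ Q <;> simp [h1, h2, Finset.insert_subset_iff]
  rw [Finset.sum_congr rfl hv, ← Finset.sum_filter_add_sum_filter_not (edgeVerts e) (fun v => v ∈ edgeVerts f)]
  have hA : ∀ v ∈ (edgeVerts e).filter (fun v => v ∈ edgeVerts f),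
      (Nat.choose (m - (insert v (edgeVerts f)).card) (k - (insert v (edgeVerts f)).card) : ℝ) =
        Nat.choose (m - 2) (k - 2) := by
    intro v hv
    rw [Finset.insert_eq_of_mem (Finset.mem_filter.1 hv).2, card_edgeVerts]
  have hB : ∀ v ∈ (edgeVerts e).filter (fun v => ¬ v ∈ edgeVerts f),
      (Nat.choose (m - (insert v (edgeVerts f)).card) (k - (insert v (edgeVerts f)).card) : ℝ) =
        Nat.choose (m - 3) (k - 3) := by
    intro v hv
    rw [Finset.card_insert_of_notMem (Finset.mem_filter.1 hv).2, card_edgeVerts]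
  rw [Finset.sum_congr rfl hA, Finset.sum_congr rfl hB, Finset.sum_const, Finset.sum_const, nsmul_eq_mul,
    nsmul_eq_mul, Finset.filter_mem_eq_inter, Finset.filter_not, Finset.filter_mem_eq_inter,
    Finset.sdiff_inter_self_left]

/-! ## The Johnson-scheme kernel identity -/

/-- **Kernel identity.** For edges `e, f` of `K_m`, `4 ≤ k`, `k + 2 ≤ m`, with `c₁ = (k-2)/(m-k)`,
`c₂ = (k-1)(k-2)/((m-k)(m-k-1))`, `A = 1 + 2c₁ + c₂`, `B = c₁ + c₂`:
`∑_{#Q = k, f ⊆ Q} (A·𝟙[e ⊆ Q] − B·#(e ∩ Q) + c₂) = C(m-2,k-2)·𝟙[e = f]`.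
(The summand equals `1`, `−c₁`, `c₂` according as `e` meets `Q` in `2, 1, 0` vertices; the three cases `e = f`,
`#(e ∪ f) = 3`, `#(e ∪ f) = 4` reduce to `C(m-3,k-2)(k-2) = C(m-3,k-3)(m-k)`, `C(m-4,k-2)(k-2) = C(m-4,k-3)(m-k-1)`,
`C(m-4,k-3)(k-3) = C(m-4,k-4)(m-k)` and Pascal's rule.) [new; Johnson scheme J(m,2)] -/
theorem johnson_kernel_at {k : ℕ} (hk : 4 ≤ k) (hm : k + 2 ≤ m) (e f : Edge m) :
    ∑ Q ∈ ((Finset.univ : Finset (Fin m)).powersetCard k).filter (fun Q => edgeVerts f ⊆ Q),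
        ((1 + 2 * ((k - 2 : ℝ) / (m - k)) + (k - 1 : ℝ) * (k - 2) / ((m - k) * (m - k - 1))) *
            (if edgeVerts e ⊆ Q then (1 : ℝ) else 0) -
          (((k - 2 : ℝ) / (m - k)) + (k - 1 : ℝ) * (k - 2) / ((m - k) * (m - k - 1))) * ((edgeVerts e ∩ Q).card : ℝ) +
          (k - 1 : ℝ) * (k - 2) / ((m - k) * (m - k - 1))) =
      (Nat.choose (m - 2) (k - 2) : ℝ) * (if e = f then 1 else 0) := by
  classical
  -- name the binomials via `M = m - 4`, `K = k - 4`
  obtain ⟨K, rfl⟩ : ∃ K, k = K + 4 := ⟨k - 4, by omega⟩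
  obtain ⟨M, rfl⟩ : ∃ M, m = M + 4 := ⟨m - 4, by omega⟩
  have hKM : K + 2 ≤ M := by omega
  -- split the sum into its three pieces
  rw [Finset.sum_add_distrib, Finset.sum_sub_distrib, ← Finset.mul_sum, ← Finset.mul_sum, Finset.sum_const,
    nsmul_eq_mul]
  -- piece 1: supersets of `edgeVerts e ∪ edgeVerts f`
  have h1 : ∑ Q ∈ ((Finset.univ : Finset (Fin (M + 4))).powersetCard (K + 4)).filter (fun Q => edgeVerts f ⊆ Q),
      (if edgeVerts e ⊆ Q then (1 : ℝ) else 0) =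
        Nat.choose (M + 4 - (edgeVerts e ∪ edgeVerts f).card) (K + 4 - (edgeVerts e ∪ edgeVerts f).card) := by
    have h4 := card_edgeVerts_union_add_inter e f
    rw [Finset.sum_filter, ← sum_powersetCard_ite_superset (edgeVerts e ∪ edgeVerts f) (by omega)]
    refine Finset.sum_congr rfl fun Q _ => ?_
    by_cases hf : edgeVerts f ⊆ Q <;> by_cases he : edgeVerts e ⊆ Q <;> simp [hf, he, Finset.union_subset_iff]
  -- piece 2: `sum_superset_card_inter`
  have h2 := sum_superset_card_inter e f (show 3 ≤ K + 4 by omega)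
  -- piece 3: the number of supersets of `edgeVerts f`
  have h3 : ((((Finset.univ : Finset (Fin (M + 4))).powersetCard (K + 4)).filter
      (fun Q => edgeVerts f ⊆ Q)).card : ℝ) = Nat.choose (M + 4 - 2) (K + 4 - 2) := by
    rw [card_filter_powersetCard_superset _ (by rw [card_edgeVerts]; omega), card_edgeVerts]
  rw [h1, h2, h3]
  have hm2 : M + 4 - 2 = M + 2 := by omega
  have hk2 : K + 4 - 2 = K + 2 := by omega
  have hm3 : M + 4 - 3 = M + 1 := by omega
  have hk3 : K + 4 - 3 = K + 1 := by omega
  rw [hm2, hk2, hm3, hk3]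
  -- the binomial identities, in ℕ then in ℝ
  have hMK : (0 : ℝ) < (M : ℝ) - K := by
    have : ((K : ℝ) + 2 ≤ M) := by exact_mod_cast hKM
    linarith
  have hMK1 : (0 : ℝ) < (M : ℝ) - K - 1 := by
    have : ((K : ℝ) + 2 ≤ M) := by exact_mod_cast hKM
    linarith
  have hK2 : (0 : ℝ) < (K : ℝ) + 2 := by positivity
  have hK1 : (0 : ℝ) < (K : ℝ) + 1 := by positivity
  have eA : (Nat.choose (M + 1) (K + 2) : ℝ) = (Nat.choose (M + 1) (K + 1) : ℝ) * ((M : ℝ) - K) / ((K : ℝ) + 2) := by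
    have h := Nat.choose_succ_right_eq (M + 1) (K + 1)
    rw [show M + 1 - (K + 1) = M - K by omega] at h
    have h' := congrArg (fun n : ℕ => (n : ℝ)) h
    push_cast [Nat.cast_sub (show K ≤ M by omega)] at h'
    field_simp
    linear_combination h'
  have eB : (Nat.choose M (K + 2) : ℝ) = (Nat.choose M (K + 1) : ℝ) * ((M : ℝ) - K - 1) / ((K : ℝ) + 2) := by
    have h := Nat.choose_succ_right_eq M (K + 1)
    rw [show M - (K + 1) = M - K - 1 by omega] at h
    have h' := congrArg (fun n : ℕ => (n : ℝ)) h
    push_cast [Nat.cast_sub (show K ≤ M by omega), Nat.cast_sub (show 1 ≤ M - K by omega)] at h'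
    field_simp
    linear_combination h'
  have eC : (Nat.choose M K : ℝ) = (Nat.choose M (K + 1) : ℝ) * ((K : ℝ) + 1) / ((M : ℝ) - K) := by
    have h := Nat.choose_succ_right_eq M K
    have h' := congrArg (fun n : ℕ => (n : ℝ)) h
    push_cast [Nat.cast_sub (show K ≤ M by omega)] at h'
    field_simp
    linear_combination -h'
  have pA : (Nat.choose (M + 2) (K + 2) : ℝ) = Nat.choose (M + 1) (K + 1) + Nat.choose (M + 1) (K + 2) := by
    rw [Nat.choose_succ_succ' (M + 1) (K + 1)]; push_cast; ring
  have pB : (Nat.choose (M + 1) (K + 1) : ℝ) = Nat.choose M K + Nat.choose M (K + 1) := by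
    rw [Nat.choose_succ_succ' M K]; push_cast; ring
  have pC : (Nat.choose (M + 1) (K + 2) : ℝ) = Nat.choose M (K + 1) + Nat.choose M (K + 2) := by
    rw [Nat.choose_succ_succ' M (K + 1)]; push_cast; ring
  -- denominators as atoms `↑(M+4)`, `↑(K+4)`
  have hden1 : ((↑(M + 4) : ℝ) - ↑(K + 4)) ≠ 0 := by push_cast; linarith
  have hden2 : ((↑(M + 4) : ℝ) - ↑(K + 4) - 1) ≠ 0 := by push_cast; linarith
  have hden3 : ((↑(K + 4) : ℝ) - 2) ≠ 0 := by push_cast; linarith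
  have eA' : (Nat.choose (M + 1) (K + 2) : ℝ) =
      (Nat.choose (M + 1) (K + 1) : ℝ) * ((↑(M + 4) : ℝ) - ↑(K + 4)) / ((↑(K + 4) : ℝ) - 2) := by
    rw [eA]; push_cast; ring
  have eB' : (Nat.choose M (K + 2) : ℝ) =
      (Nat.choose M (K + 1) : ℝ) * ((↑(M + 4) : ℝ) - ↑(K + 4) - 1) / ((↑(K + 4) : ℝ) - 2) := by
    rw [eB]; push_cast; ring
  have eC' : (Nat.choose M K : ℝ) =
      (Nat.choose M (K + 1) : ℝ) * ((↑(K + 4) : ℝ) - 3) / ((↑(M + 4) : ℝ) - ↑(K + 4)) := by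
    rw [eC]; push_cast; ring
  -- case analysis on the mutual position of `e` and `f`
  by_cases hef : e = f
  · subst hef
    rw [if_pos rfl, Finset.union_self, Finset.inter_self, Finset.sdiff_self, card_edgeVerts, Finset.card_empty,
      hm2, hk2]
    push_cast
    ring
  · rw [if_neg hef]
    have hU := three_le_card_edgeVerts_union hef
    have hUI := card_edgeVerts_union_add_inter e f
    have hsd := card_edgeVerts_sdiff e f
    rcases Nat.lt_or_ge (edgeVerts e ∪ edgeVerts f).card 4 with hlt | hge
    · -- the edges share exactly one vertex
      have hU3 : (edgeVerts e ∪ edgeVerts f).card = 3 := by omega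
      have hI1 : (edgeVerts e ∩ edgeVerts f).card = 1 := by omega
      have hS1 : (edgeVerts e \ edgeVerts f).card = 1 := by omega
      rw [hU3, hI1, hS1, hm3, hk3, pA, eA']
      simp only [Nat.cast_one]
      field_simp
      ring
    · -- disjoint edges
      have hU4 : (edgeVerts e ∪ edgeVerts f).card = 4 := by
        have : (edgeVerts e ∪ edgeVerts f).card ≤ 4 := by omega
        omega
      have hI0 : (edgeVerts e ∩ edgeVerts f).card = 0 := by omega
      have hS2 : (edgeVerts e \ edgeVerts f).card = 2 := by omega
      have hm4 : M + 4 - 4 = M := by omega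
      have hk4 : K + 4 - 4 = K := by omega
      rw [hU4, hI0, hS2, hm4, hk4, pA, pB, pC, eB', eC']
      simp only [Nat.cast_zero, Nat.cast_ofNat]
      field_simp
      ring


/-- **Kernel identity** (registered form of `johnson_kernel_at`, all parameters explicit):
`∑_{#Q = k, Q ⊇ f} (A·𝟙[e ⊆ Q] − B·#(e ∩ Q) + c₂) = C(m-2,k-2)·𝟙[e = f]` for `4 ≤ k`, `k + 2 ≤ m`. [new] -/
theorem johnson_kernel : ∀ {m k : ℕ}, 4 ≤ k → k + 2 ≤ m → ∀ (e f : Edge m), ∑ Q ∈ ((Finset.univ : Finset (Fin m)).powersetCard k).filter (fun Q => edgeVerts f ⊆ Q), ((1 + 2 * ((k - 2 : ℝ) / (m - k)) + (k - 1 : ℝ) * (k - 2) / ((m - k) * (m - k - 1))) * (if edgeVerts e ⊆ Q then (1 : ℝ) else 0) - (((k - 2 : ℝ) / (m - k)) + (k - 1 : ℝ) * (k - 2) / ((m - k) * (m - k - 1))) * ((edgeVerts e ∩ Q).card : ℝ) + (k - 1 : ℝ) * (k - 2) / ((m - k) * (m - k - 1))) = (Nat.choose (m - 2) (k - 2) :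 ℝ) * (if e = f then 1 else 0) :=
  fun hk hm e f => johnson_kernel_at hk hm e f

/-! ## From the kernel identity to inequalities on valid weightings -/

/-- **Transfer identity.** If a coefficient system `g(e,Q)` on edges × `k`-sets has kernel `∑_{Q ⊇ f} g(e,Q) = C·[e = f]`,
then for all edge functions `ω, w`: `∑_Q (∑_e ω(e) g(e,Q)) · w(E(Q)) = C · ∑_e ω(e) w(e)`. [new packaging] -/
theorem sum_sum_mul_softWindow_of_kernel {k : ℕ} (g : Edge m → Finset (Fin m) → ℝ) (C : ℝ)
    (hker : ∀ e f : Edge m,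
      ∑ Q ∈ ((Finset.univ : Finset (Fin m)).powersetCard k).filter (fun Q => edgeVerts f ⊆ Q), g e Q =
        C * (if e = f then 1 else 0))
    (ω w : Edge m → ℝ) :
    ∑ Q ∈ (Finset.univ : Finset (Fin m)).powersetCard k, (∑ e, ω e * g e Q) * softWindow w Q =
      C * ∑ e, ω e * w e := by
  classical
  have hQ : ∀ Q : Finset (Fin m), (∑ e, ω e * g e Q) * softWindow w Q =
      ∑ e, ∑ f, ω e * w f * (if edgeVerts f ⊆ Q then g e Q else 0) := by
    intro Q
    unfold softWindow
    rw [Finset.sum_filter, Finset.sum_mul]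
    refine Finset.sum_congr rfl fun e _ => ?_
    rw [Finset.mul_sum]
    refine Finset.sum_congr rfl fun f _ => ?_
    split_ifs <;> ring
  calc ∑ Q ∈ (Finset.univ : Finset (Fin m)).powersetCard k, (∑ e, ω e * g e Q) * softWindow w Q
      = ∑ e, ∑ f, ω e * w f *
          ∑ Q ∈ (Finset.univ : Finset (Fin m)).powersetCard k, (if edgeVerts f ⊆ Q then g e Q else 0) := by
        rw [Finset.sum_congr rfl fun Q _ => hQ Q, Finset.sum_comm]
        refine Finset.sum_congr rfl fun e _ => ?_
        rw [Finset.sum_comm]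
        refine Finset.sum_congr rfl fun f _ => ?_
        rw [Finset.mul_sum]
    _ = ∑ e, ∑ f, ω e * w f * (C * (if e = f then 1 else 0)) := by
        refine Finset.sum_congr rfl fun e _ => Finset.sum_congr rfl fun f _ => ?_
        rw [← Finset.sum_filter, hker e f]
    _ = C * ∑ e, ω e * w e := by
        rw [Finset.mul_sum]
        refine Finset.sum_congr rfl fun e _ => ?_
        rw [Finset.sum_eq_single e]
        · simp
          ring
        · intro f _ hfe
          rw [if_neg (Ne.symm hfe)]
          ring
        · intro he
          exact absurd (Finset.mem_univ e) he

/-- **Positivity transfer.** Under the kernel identity with `C > 0`: if every coefficient `λ_Q(ω) = ∑_e ω(e) g(e,Q)` is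
`≥ 0` on `k`-sets and `w` is `k`-clique-non-negative, then `⟨ω, w⟩ ≥ 0`. [new packaging] -/
theorem inner_nonneg_of_kernel {k : ℕ} (g : Edge m → Finset (Fin m) → ℝ) {C : ℝ} (hC : 0 < C)
    (hker : ∀ e f : Edge m,
      ∑ Q ∈ ((Finset.univ : Finset (Fin m)).powersetCard k).filter (fun Q => edgeVerts f ⊆ Q), g e Q =
        C * (if e = f then 1 else 0))
    (ω w : Edge m → ℝ)
    (hlam : ∀ Q ∈ (Finset.univ : Finset (Fin m)).powersetCard k, 0 ≤ ∑ e, ω e * g e Q)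
    (hw : ∀ Q ∈ (Finset.univ : Finset (Fin m)).powersetCard k, 0 ≤ softWindow w Q) :
    0 ≤ ∑ e, ω e * w e := by
  have h := sum_sum_mul_softWindow_of_kernel g C hker ω w
  have hnn : 0 ≤ ∑ Q ∈ (Finset.univ : Finset (Fin m)).powersetCard k, (∑ e, ω e * g e Q) * softWindow w Q :=
    Finset.sum_nonneg fun Q hQ => mul_nonneg (hlam Q hQ) (hw Q hQ)
  rw [h] at hnn
  exact (mul_nonneg_iff_of_pos_left hC).1 hnn

end

end Summit.PneNP.PneNP.Theorems
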